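import Summits.CriticalPhenomena.PercolationContinuityZ3.Theorems.Transplant.KNCellsStepsPinO
import Summits.CriticalPhenomena.PercolationContinuityZ3.Theorems.Transplant.KNCellsStepsPin
import Summits.CriticalPhenomena.PercolationContinuityZ3.Theorems.Transplant.KNLevelsDefs
import Summits.CriticalPhenomena.PercolationContinuityZ3.Theorems.Transplant.KNCellsSchemeO
import Summits.CriticalPhenomena.PercolationContinuityZ3.Theorems.Transplant.KNCellsProcessO
import Summits.CriticalPhenomena.PercolationContinuityZ3.Theorems.Transplant.KNCellsStepsDefsO
import Summits.CriticalPhenomena.PercolationContinuityZ3.Theorems.Transplant.KNCellsStepsReachO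
import Summits.CriticalPhenomena.PercolationContinuityZ3.Theorems.Transplant.KNCellsStepsSubbox
import Literature.Probability.Percolation.OrientedHistorySiteRenormalizationRun
import HarnessLib

/-!
# N2 (frames-only node `SamePDropOfSkeletonFrm₁`, OPEN) — ORIENTED MACRO LAYER (WAVE 0 (c1), (R-18) `q ≡ true`): the oriented twin of N1's `KNCellsStepsSubbox`

builds on p205010 (kernel theorem, internal audit signed; external expert review pending) — nothing in this file uses p205010; NOTHING is claimed about the
open node `SamePDropOfSkeletonFrm₁` (`SamePDropOfSkeletonNeg₁` is CLOSED in the tree and untouched by this file).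
Status sentence (coordinator 2026-08-20T04:30Z): "θ(p_c) = 0 on ℤ^d, all d ≥ 2 — kernel-verified (Lean 4/Mathlib, standard axioms); internal adversarial
audit SIGNED 2026-08-20 04:29Z; external expert review pending."
Lane `prim-bschramm-*`, seat `prim-bschramm-stmt` (gen 19); helper file (`--supports stmt-CriticalPhenomena-4575 --as helper`); N2-SCOPE §20, (R-18)/(R-19).
PORT RULES (HOME/prim-bschramm-stmt-g19/lean/port_orient.py): the history-site API is replaced by its ORIENTED twin at the fixed quadrant `qNE := fun _ => true`
(`HState.choice ↦ HState.ochoice qNE`, `mstOf ↦ omstOf qNE`, `mst/stN ↦ omst/ostN qNE`, `occFinal ↦ ooccFinal qNE`, `Lawful ↦ OLawful qNE`, onward directions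
`onward ↦ onwardO` = the POSITIVE ones, (N2-e)); every declaration whose text changes thereby — directly or through a changed declaration — is re-declared with the
suffix `O` (same namespace); unchanged declarations of the N1 file are NOT repeated (the N1 module is imported). Docstrings/citations are N1's.
N1 HEADER (kept for the reader):
* `Wt_apply_of_not_mem_wireSet`, `Wt_apply_of_not_mem_Fj`, **`finSupp_Wt`**, **`isSubbox_Wt`**;
* **`finSupp_Wpin`**, **`isSubbox_Wpin`**.
[cite: KozmaNitzan2024, §4 p. 17 (subbox), p. 31 (D is a subbox of Ω) — the ℤ^d model] [cite: GrimmettPercolation1999, §7.2]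
-/
noncomputable section

open MeasureTheory ProbabilityTheory
open scoped ENNReal Classical

namespace Summit.CriticalPhenomena.PercolationContinuityZ3.Theorems

namespace Transplant

namespace KNCells

open Literature.Probability.Percolation Literature.Probability.LatticeModels SimpleGraph GadgetSystem ProbeHistory HSiteScheme Contour

variable {V : Type*} [DecidableEq V]

namespace KSchA

variable {A : Type*} {G : SimpleGraph V} [G.LocallyFinite] {S : KSchA V A}
variable {h : ProbeHistory V} {e : Site 2 × MDir} {a a' : A} {du : MDir} {j : ℕ} {o P : Finset (Sym2 V)}

/-! ## The weighting of (30) -/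

/-! ## The weighting of (I1) -/

/-- **`Wpin` is a subbox weighting on every `Dd ⊆ E_i ∪ E_{w,v} ∪ E_{v,x}` disjoint from `E_i ∪ E_{w,v}`** (valid history: the explored edges are
the edges of `E_i`). [cite: KozmaNitzan2024, §4 p. 31 (D is a subbox of Ω)] -/
theorem isSubbox_WpinO (hV : S.ValidO G h e) (hP : P ⊆ S.Bfr G h e a) {Dd : Finset V} (hD : Dd ⊆ S.Sx G h e a a' du)
    (hdis : Disjoint Dd (S.Vx G h ∪ S.Γ.Ewv a e.1 e.2)) :
    KNLevels.IsSubbox G (S.Wpin G h e a a' du P) S.p Dd := by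
  have hF : S.F G h = edgesIn G (S.Vx G h) := hV.F_eq
  refine ⟨fun u hu v hv huv => ?_, fun u hu v hv hne huv => ?_, fun v hv hvb x hx => ?_⟩
  · rw [Wpin_apply_of_not_mem_baseO hF (Finset.disjoint_left.1 hdis hu)
      (mk_mem_wireSet_iff.2 ⟨Finset.mem_coe.2 (hD hu), Finset.mem_coe.2 (hD hv), huv.ne⟩),
      KNLevels.lattW_apply, if_pos ((SimpleGraph.mem_edgeSet G).2 huv)]
  · rw [Wpin_apply_of_not_mem_baseO hF (Finset.disjoint_left.1 hdis hu)
      (mk_mem_wireSet_iff.2 ⟨Finset.mem_coe.2 (hD hu), Finset.mem_coe.2 (hD hv), hne⟩),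
      KNLevels.lattW_apply, if_neg (fun h' => huv ((SimpleGraph.mem_edgeSet G).1 h'))]
  · have hnadj : ¬G.Adj x v := fun hadj => hvb (mem_innerBoundary_iff.2 ⟨hv, x, hx, hadj.symm⟩)
    have _ := hP
    by_cases hxS : s(x, v) ∈ wireSet (↑(S.Sx G h e a a' du) : Set V)
    · rw [Sym2.eq_swap, Wpin_apply_of_not_mem_baseO hF (Finset.disjoint_left.1 hdis hv) (by rwa [Sym2.eq_swap]), KNLevels.lattW_apply,
        if_neg (fun h' => hnadj ((SimpleGraph.mem_edgeSet G).1 h').symm)]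
    · exact Wpin_apply_of_not_mem_wireSetO hP hxS

end KSchA

end KNCells

end Transplant

end Summit.CriticalPhenomena.PercolationContinuityZ3.Theorems

end
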